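import Summits.CriticalPhenomena.PercolationContinuityZ3.Theorems.Transplant.KNCellsBoxProdZ2Conc
import HarnessLib

/-!
# The concentric `X □ ℤ²` cell geometry WITH A THIN FAR BOX (supersedes `KNCellsBoxProdZ2Conc`'s `cellGeomCF`, where `E^far` had the cube
# radius): schedule `⟨E, F, ρ, rM⟩` — cubes / between-boxes / zones of depth `b` at fibre radius `E b`, the far box `E^far` at `F b ≤ E b`,
# corridor profile `ρ b`, target cube `rM b ≤ F b` — and the six geometry records of `samePWitnessAt_of_kit₂'`

builds on p205010 (kernel theorem, internal audit signed; external expert review pending) — nothing in this file uses p205010.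
Lane `prim-bschramm`, seat `prim-bschramm-p3` (order I1/I2 of V56); helper file (`--supports stmt-CriticalPhenomena-4575 --as helper`).

WHY `F < E` (seat analysis 14:04Z, HOME/prim-bschramm-p3/STATUS.md): the conditional step `cond_j` of `(v, du)` runs under the law restricted to
`E_i ∪ E_{w,v} ∪ E^far`, so its habitat on the corridor rows has the far box's fibre radius `F b` and it certifies the target `M` at radius
`≥ F b - L'`; the NEXT examination's corridor chain (KN Lemma 12, `hreach`) runs in `E_i ∪ E_{v,x} ∪ H_{x,·}` at the cube radius `E b` with
source `M`; the source is deep in that habitat iff `F b + gap ≤ E b`.  The records below need only the order facts `ConcRadiiF.WF`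
(`E (b-1) ≤ E b`, `ρ b ℓ ≤ F b ≤ E b`, `ρ b ℓ ≤ E (b-1)` on levels `≤ 5r`, `rM b ≤ F b`); the gaps enter the kit discharge.
* `ConcRadiiF`, `ConcRadiiF.WF`; `cellGeomCF X C w₀ Λ : CellGeom (W × Site 2) ℕ` (as `cellGeomCF` but `Efar b v δ = B(w₀, F b) × Efar_v,δ`),
  `faceDataCF`; the staircase sets `stair` and `levelDataC` are those of `KNCellsBoxProdZ2Conc`;
* **`runGeomCF`, `anchGeomCF`, `sepGeomCF`, `sepGeom₂CF`, `exitGeomCF`, `stepsGeomCF`, `levelGeomCF`**.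

[cite: KozmaNitzan2024, §4 pp. 25–27, 30–31 (Q_v, M_v, E_{v,x}, H^j_{v,x}, F^j_{v,x}) — the ℤ^d model]
-/

noncomputable section

open scoped Classical

namespace Summit.CriticalPhenomena.PercolationContinuityZ3.Theorems

namespace Transplant

namespace BoxProdZ2

open Literature.Probability.Percolation Literature.Probability.LatticeModels SimpleGraph GadgetSystem Contour KNCells
open Literature.Probability.Percolation.KozmaNitzan.Cells (oth oth_ne oth_oth sgOf sgOf_sign stepVec_apply_fst stepVec_apply_oth eq_oth_of_ne)
open Literature.Barriers.CriticalPhenomena (graphBall graphBall_finite mem_graphBall_self graphBall_mono)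

variable {W : Type} (X : SimpleGraph W) [X.LocallyFinite]

/-! ## §1 The radius schedule with a thin far box -/

/-- **The fibre-radius schedule with a thin far box**: cube / between-box / zone radius `E b` of depth `b`, far-box radius `F b`, corridor
profile `ρ b ℓ` (stubs / faces / corridor of depth `b` at planar level `ℓ`), target-cube radius `rM b`. [this work] -/
structure ConcRadiiF where
  /-- fibre radius of the cube `Q b`, the between-box `Btw b` and the zone `Zone b` -/
  E : ℕ → ℕ
  /-- fibre radius of the far box `Efar b` (the habitat of the conditional steps of depth `b`) -/
  F : ℕ → ℕ
  /-- fibre radius of the corridor sets of depth `b` (stubs, faces, `H`) at planar level `ℓ` -/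
  ρ : ℕ → ℤ → ℕ
  /-- fibre radius of the target cube `M b` -/
  rM : ℕ → ℕ

/-- **Well-formedness of a schedule** w.r.t. the planar cells `C` — exactly what the six geometry records use: cube radii do not decrease
with the depth; corridor profile within the far box, far box within the cube radius; on the levels `≤ 5r` (the stub's base row, inside the
cube of the PREVIOUS depth) the profile stays within `E (b-1)`; the target cube within the far box. [this work] -/
structure ConcRadiiF.WF (C : PCells) (Λ : ConcRadiiF) : Prop where
  /-- probe radii do not decrease -/
  mono : ∀ b, Λ.E b ≤ Λ.E (b + 1)
  /-- the corridor profile stays inside the far box of its own depth -/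
  ρ_le_F : ∀ b ℓ, Λ.ρ b ℓ ≤ Λ.F b
  /-- the far box is not fatter than the cube / between-box of its depth -/
  F_le : ∀ b, Λ.F b ≤ Λ.E b
  /-- on the base levels the profile stays inside the cube of the previous depth -/
  ρ_base : ∀ b ℓ, ℓ ≤ 5 * (C.r : ℤ) → Λ.ρ b ℓ ≤ Λ.E (b - 1)
  /-- the target cube lies in the far box -/
  rM_le_F : ∀ b, Λ.rM b ≤ Λ.F b

/-- The schedule without the far-box radius (a `KNCellsBoxProdZ2Conc.ConcRadii`). [folklore] -/
def ConcRadiiF.base (Λ : ConcRadiiF) : ConcRadii := ⟨Λ.E, Λ.ρ, Λ.rM⟩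

namespace ConcRadiiF.WF

variable {C : PCells} {Λ : ConcRadiiF} (hΛ : Λ.WF C)
include hΛ

/-- `ρ b ℓ ≤ E b`. [folklore] -/
theorem ρ_le (b : ℕ) (ℓ : ℤ) : Λ.ρ b ℓ ≤ Λ.E b := (hΛ.ρ_le_F b ℓ).trans (hΛ.F_le b)

/-- `rM b ≤ E b`. [folklore] -/
theorem rM_le (b : ℕ) : Λ.rM b ≤ Λ.E b := (hΛ.rM_le_F b).trans (hΛ.F_le b)

/-- Well-formedness passes to the schedule without the far-box radius. [folklore] -/
theorem base_wf : Λ.base.WF C :=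
  ⟨hΛ.mono, fun b ℓ => (hΛ.ρ_le_F b ℓ).trans (hΛ.F_le b), hΛ.ρ_base, fun b => (hΛ.rM_le_F b).trans (hΛ.F_le b)⟩

end ConcRadiiF.WF

/-! ## §2 The cell geometry -/

section Geom

variable [DecidableEq W]

/-- **The concentric `X □ ℤ²` cell geometry with a thin far box** over the anchor type `ℕ` (depth): as `cellGeomC` except
`Efar b v δ = B_X(w₀, F b) × Efar_v,δ`; staircase stubs; anchor rule `a ↦ a + 1`, admissible anchors `{a, a+1}`.
[cite: KozmaNitzan2024, §4 pp. 25–26 (Q_v, M_v, E_{v,x}, H^j_{v,x})] -/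
def cellGeomCF (C : PCells) (w₀ : W) (Λ : ConcRadiiF) : CellGeom (W × Site 2) ℕ where
  K := C.K
  root := (w₀, 0)
  a₀ := 0
  Q := fun a v => ballFin X w₀ (Λ.E a) ×ˢ C.Q v
  M := fun a v => ballFin X w₀ (Λ.rM a) ×ˢ C.M v
  Cell := fun a v => ballFin X w₀ (Λ.E (a + 1)) ×ˢ C.Cell v
  Btw := fun a v δ => ballFin X w₀ (Λ.E a) ×ˢ C.Btw v δ
  Efar := fun a v δ => ballFin X w₀ (Λ.F a) ×ˢ C.Efar v δ
  Stub := fun a v δ j => stair X w₀ (fun t => Λ.ρ a (C.lev δ v t)) (C.Stub v δ j)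
  Zone := fun a v δ => ballFin X w₀ (Λ.E a) ×ˢ C.Zone v δ
  col := fun x => {y | y.2 = C.cen x}
  anchor := fun a _ _ => a + 1
  anchSet := fun a _ => {a, a + 1}
  anchor_mem := fun a _ _ => Finset.mem_insert_of_mem (Finset.mem_singleton_self _)
  stub_mono := fun _ v δ _ _ h => stair_mono X (C.Stub_mono v δ h) fun _ _ => le_rfl
  hK := by have := C.hK; omega

/-- **Faces and corridors** of the concentric geometry: staircases with the same profile as the stubs. [cite: KozmaNitzan2024, §4 p. 26 (H_{v,x}), p. 30 (F^j_{v,x})] -/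
def faceDataCF (C : PCells) (w₀ : W) (Λ : ConcRadiiF) : FaceData (W × Site 2) ℕ where
  Face := fun a v δ j => stair X w₀ (fun t => Λ.ρ a (C.lev δ v t)) (C.Face v δ j)
  Hfull := fun a v δ => stair X w₀ (fun t => Λ.ρ a (C.lev δ v t)) (C.Hfull v δ)


variable (C : PCells) (w₀ : W) {Λ : ConcRadiiF} (hΛ : Λ.WF C)
/-! ## §3 The six records -/
/-- `RunGeom`: planar steps inside the boxes (transverse steps inside the staircase stubs). [folklore] -/
theorem runGeomCF : RunGeom (X □ zdGraph 2) (cellGeomCF X C w₀ Λ) where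
  adjQ _ v _ hy := exists_adj_product X (fun _ ht => C.exists_adj_of_mem_Q v ht) hy
  adjBtw _ v δ _ hy := exists_adj_product X (fun _ ht => C.exists_adj_of_mem_Btw v δ ht) hy
  adjStub a v δ j _ y hy := by
    change y ∈ stair X w₀ (fun t => Λ.ρ a (C.lev δ v t)) (C.Stub v δ j) at hy
    rw [mem_stair] at hy
    obtain ⟨t', ht', hadj, hlev⟩ := exists_adj_sameLevel_of_mem_Stub C v δ j hy.1
    refine ⟨(y.1, t'), ?_, (boxProd_adj).2 (Or.inr ⟨hadj, rfl⟩)⟩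
    change (y.1, t') ∈ stair X w₀ (fun t => Λ.ρ a (C.lev δ v t)) (C.Stub v δ j)
    rw [mem_stair]
    refine ⟨ht', ?_⟩
    change y.1 ∈ ballFin X w₀ (Λ.ρ a (C.lev δ v t'))
    rw [hlev]; exact hy.2

/-- `AnchGeom`: `a ∈ {a, a+1}`, and the admissible anchors do not depend on the macro-vertex. [folklore] -/
theorem anchGeomCF : AnchGeom (cellGeomCF X C w₀ Λ) where
  refl a _ := Finset.mem_insert_self a {a + 1}
  const _ _ _ := rfl

include hΛ

/-- **`SepGeom`** for the concentric geometry (containments from the schedule's order, disjointness / separation planar). [cite: KozmaNitzan2024, §4 pp. 26–29] -/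
theorem sepGeomCF : SepGeom (X □ zdGraph 2) (cellGeomCF X C w₀ Λ) where
  anch_refl a _ := Finset.mem_insert_self a {a + 1}
  root_mem := by
    change (w₀, (0 : Site 2)) ∈ ballFin X w₀ (Λ.E 0) ×ˢ C.Q 0
    exact Finset.mem_product.2 ⟨(mem_ballFin X).2 (mem_graphBall_self X w₀ _), C.zero_mem_Q_zero⟩
  Q_subset_Cell a v := Finset.product_subset_product (ballFin_mono X w₀ (hΛ.mono a)) (C.Q_subset_Cell v)
  Btw_subset_Cells a a' v δ ha' := by
    obtain ⟨-, -, h3⟩ := hΛ.base_wf.E_of_mem ha'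
    change ballFin X w₀ (Λ.E a') ×ˢ C.Btw v δ ⊆ ballFin X w₀ (Λ.E (a + 1)) ×ˢ C.Cell v ∪ ballFin X w₀ (Λ.E (a' + 1)) ×ˢ C.Cell (v + stepVec δ)
    exact product_subset_union (ballFin_mono X w₀ h3) (ballFin_mono X w₀ (hΛ.mono a')) (C.Btw_subset_Cells v δ)
  Stub_subset_Q_union_Btw a a' v δ j ha' hj := by
    obtain ⟨h1, -, -⟩ := hΛ.base_wf.E_of_mem ha'
    change stair X w₀ (fun t => Λ.ρ a' (C.lev δ v t)) (C.Stub v δ j) ⊆ ballFin X w₀ (Λ.E a) ×ˢ C.Q v ∪ ballFin X w₀ (Λ.E a') ×ˢ C.Btw v δ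
    refine stair_subset_union X (C.Stub_subset_Q_union_Btw v δ (by change j + 1 ≤ C.K at hj; omega)) ?_ ?_
    · intro t _ htQ
      exact (hΛ.ρ_base a' _ (C.lev_le_of_mem_Q htQ)).trans h1
    · intro t _ _; exact hΛ.ρ_le a' _
  Stub_subset_Cell_union_Zone a a' v δ j ha' hj := by
    obtain ⟨-, -, h3⟩ := hΛ.base_wf.E_of_mem ha'
    change stair X w₀ (fun t => Λ.ρ a' (C.lev δ v t)) (C.Stub v δ j) ⊆
      ballFin X w₀ (Λ.E (a + 1)) ×ˢ C.Cell v ∪ ballFin X w₀ (Λ.E a') ×ˢ C.Zone v δ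
    refine stair_subset_union X (C.Stub_subset_Cell_union_Zone v δ (by change j + 1 ≤ C.K at hj; omega)) ?_ ?_
    · intro t _ _; exact (hΛ.ρ_le a' _).trans h3
    · intro t _ _; exact hΛ.ρ_le a' _
  Efar_subset_Btw_union_Q a v δ := by
    change ballFin X w₀ (Λ.F a) ×ˢ C.Efar v δ ⊆ ballFin X w₀ (Λ.E a) ×ˢ C.Btw v δ ∪ ballFin X w₀ (Λ.E a) ×ˢ C.Q (v + stepVec δ)
    exact product_subset_union (ballFin_mono X w₀ (hΛ.F_le a)) (ballFin_mono X w₀ (hΛ.F_le a)) (C.Efar_subset_Btw_union_Q v δ)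
  Ewv_disjoint_Efar a a' w δw du hdu := by
    change Disjoint (ballFin X w₀ (Λ.E a) ×ˢ C.Btw w δw ∪ ballFin X w₀ (Λ.E a) ×ˢ C.Q (w + stepVec δw))
      (ballFin X w₀ (Λ.F a') ×ˢ C.Efar (w + stepVec δw) du)
    have h := C.Ewv_disjoint_Efar w hdu
    rw [PCells.Ewv, Finset.disjoint_union_left] at h
    rw [Finset.disjoint_union_left]
    exact ⟨disjoint_product_of_right h.1, disjoint_product_of_right h.2⟩
  Q_disjoint_Q a a' u x hux := disjoint_product_of_right (C.Q_disjoint_Q hux)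
  Q_disjoint_Btw a a' x v δ := disjoint_product_of_right (C.Q_disjoint_Btw x v δ)
  Btw_disjoint_Btw a a' v δ v' δ' h1 h2 := disjoint_product_of_right (C.Btw_disjoint_Btw h1 h2)
  Q_disjoint_Efar a a' v δ := disjoint_product_of_right (C.Q_disjoint_Efar v δ)
  Btw_disjoint_Efar a a' v δ δ' h := disjoint_product_of_right (C.Btw_disjoint_Efar v h)
  col_Q a x := ⟨(w₀, C.cen x), Finset.mem_product.2 ⟨(mem_ballFin X).2 (mem_graphBall_self X w₀ _), C.cen_mem_Q x⟩, rfl⟩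
  col_Cell a u x hux y hy hcol := by
    change y.2 = C.cen x at hcol
    exact C.cen_not_mem_Cell hux (hcol ▸ (Finset.mem_product.1 hy).2)
  col_Zone a u δ x y hy hcol := by
    change y.2 = C.cen x at hcol
    exact C.cen_not_mem_Zone u δ x (hcol ▸ (Finset.mem_product.1 hy).2)

/-- **`SepGeom₂`** (cross-anchor containments `Q_a ⊆ Cell_{a'}`, `Btw_a ⊆ Cell_a ∪ Cell_{a'}` for `a' ∈ {a, a+1}`). [cite: KozmaNitzan2024, §4 pp. 25–26] -/
theorem sepGeom₂CF : SepGeom₂ (X □ zdGraph 2) (cellGeomCF X C w₀ Λ) where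
  toSepGeom := sepGeomCF X C w₀ hΛ
  Q_subset_Cell₂ a a' x ha' := by
    obtain ⟨-, h2, -⟩ := hΛ.base_wf.E_of_mem ha'
    change ballFin X w₀ (Λ.E a) ×ˢ C.Q x ⊆ ballFin X w₀ (Λ.E (a' + 1)) ×ˢ C.Cell x
    exact Finset.product_subset_product (ballFin_mono X w₀ (h2.trans (hΛ.mono a'))) (C.Q_subset_Cell x)
  Btw_subset_Cells₂ a a' v δ ha' := by
    obtain ⟨-, h2, -⟩ := hΛ.base_wf.E_of_mem ha'
    change ballFin X w₀ (Λ.E a) ×ˢ C.Btw v δ ⊆ ballFin X w₀ (Λ.E (a + 1)) ×ˢ C.Cell v ∪ ballFin X w₀ (Λ.E (a' + 1)) ×ˢ C.Cell (v + stepVec δ)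
    exact product_subset_union (ballFin_mono X w₀ (hΛ.mono a)) (ballFin_mono X w₀ (h2.trans (hΛ.mono a'))) (C.Btw_subset_Cells v δ)

/-- **`ExitGeom`** for the concentric geometry. [cite: KozmaNitzan2024, §4 pp. 26–27] -/
theorem exitGeomCF : ExitGeom (X □ zdGraph 2) (cellGeomCF X C w₀ Λ) where
  M_subset_Q a v := Finset.product_subset_product (ballFin_mono X w₀ (hΛ.rM_le a)) (C.M_subset_Q v)
  Cell_disjoint_Q a a' u x hux := disjoint_product_of_right (C.Cell_disjoint_Q hux)
  Zone_disjoint_Q a a' u δ x := disjoint_product_of_right (C.Zone_disjoint_Q u δ x)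
  locFin y := by
    set B : Site 2 := fun i => |y.2 i| + 35 * C.r + 1 with hB
    refine (Finset.Icc (-B) B).finite_toSet.subset ?_
    rintro v ⟨a, w, δ, rfl, b, hb, hadj⟩
    change b ∈ ballFin X w₀ (Λ.E a) ×ˢ C.Btw w δ ∪ ballFin X w₀ (Λ.E a) ×ˢ C.Q (w + stepVec δ) at hb
    have hb2 : b.2 ∈ C.Ewv w δ := by
      rw [PCells.Ewv, Finset.mem_union]
      rcases Finset.mem_union.1 hb with h | h
      · exact Or.inl (Finset.mem_product.1 h).2
      · exact Or.inr (Finset.mem_product.1 h).2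
    have hnear : ∀ i, |b.2 i - y.2 i| ≤ 1 := by
      intro i
      rcases (boxProd_adj).1 hadj with ⟨-, h2⟩ | ⟨h2, -⟩
      · rw [h2, sub_self, abs_zero]; exact zero_le_one
      · exact abs_sub_comm (b.2 i) (y.2 i) ▸ DCT16.abs_sub_le_one_of_adj h2 i
    rw [Finset.coe_Icc, Set.mem_Icc]
    have key : ∀ i, |(w + stepVec δ) i| ≤ B i := by
      intro i
      have h1 := sub_cen_le_of_mem_Ewv C hb2 i
      have h2 := hnear i
      rw [abs_le] at h1 h2 ⊢
      simp only [PCells.cen_apply] at h1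
      simp only [hB]
      have hy := abs_nonneg (y.2 i)
      have hy' := le_abs_self (y.2 i)
      have hy'' := neg_abs_le (y.2 i)
      have hr : (1 : ℤ) ≤ C.r := by exact_mod_cast C.one_le_r
      constructor <;> nlinarith
    exact ⟨fun i => (abs_le.1 (key i)).1, fun i => (abs_le.1 (key i)).2⟩

/-- **`StepsGeom`** for the concentric geometry (faces ⊆ stubs ⊆ corridor: same profile; corridor ⊆ `Q_{arr} ∪ E^far`: base levels within
`E (b-1)`). [cite: KozmaNitzan2024, §4 pp. 26, 30] -/
theorem stepsGeomCF : StepsGeom (cellGeomCF X C w₀ Λ) (faceDataCF X C w₀ Λ) where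
  Face_subset_Stub a v δ j := stair_mono X (C.Face_subset_Stub v δ j) fun _ _ => le_rfl
  Stub_subset_Hfull a v δ j hj := stair_mono X (C.Stub_subset_Hfull v δ (by change j ≤ C.K at hj; exact hj)) fun _ _ => le_rfl
  Hfull_subset a a' v δ ha' := by
    obtain ⟨h1, -, -⟩ := hΛ.base_wf.E_of_mem ha'
    change stair X w₀ (fun t => Λ.ρ a' (C.lev δ v t)) (C.Hfull v δ) ⊆ ballFin X w₀ (Λ.E a) ×ˢ C.Q v ∪ ballFin X w₀ (Λ.F a') ×ˢ C.Efar v δ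
    refine stair_subset_union X (C.Hfull_subset_Q_union_Efar v δ) ?_ ?_
    · intro t _ htQ
      exact (hΛ.ρ_base a' _ (C.lev_le_of_mem_Q htQ)).trans h1
    · intro t _ _; exact hΛ.ρ_le_F a' _
  M_tgt_subset_Efar a v δ := Finset.product_subset_product (ballFin_mono X w₀ (hΛ.rM_le_F a)) (C.M_add_stepVec_subset_Efar v δ)

/-- **`LevelGeom`** for the concentric geometry (the staircase truncated at `L j` is the stub `H^j`; everything else planar). [cite: KozmaNitzan2024, §4 p. 31 (Step IV)] -/
theorem levelGeomCF : LevelGeom (X □ zdGraph 2) (cellGeomCF X C w₀ Λ) (faceDataCF X C w₀ Λ) (levelDataC (W := W) C) where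
  adj_le a' v δ y z h := by
    change C.lev δ v z.2 ≤ C.lev δ v y.2 + 1
    rcases (boxProd_adj).1 h with ⟨-, h2⟩ | ⟨h2, -⟩
    · rw [h2]; omega
    · rcases C.lev_adj δ v h2 with h' | h' | h' <;> omega
  lev_Q a a' v δ _ y hy := C.lev_le_of_mem_Q (Finset.mem_product.1 hy).2
  lev_Hfull a' v δ y hy hn := by
    change y ∈ stair X w₀ (fun t => Λ.ρ a' (C.lev δ v t)) (C.Hfull v δ) at hy
    rw [mem_stair] at hy
    refine lev_le_of_mem_Hfull_not_Efar' C hy.1 fun h' => hn ?_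
    change y ∈ ballFin X w₀ (Λ.F a') ×ˢ C.Efar v δ
    exact Finset.mem_product.2 ⟨ballFin_mono X w₀ (hΛ.ρ_le_F a' _) hy.2, h'⟩
  ℓQ_lt j hj := by
    change 5 * (C.r : ℤ) < 5 * C.r + 10 * C.s * j
    have hs1 : (1 : ℤ) ≤ C.s := by exact_mod_cast C.hs
    have : (1 : ℤ) ≤ j := by exact_mod_cast hj
    nlinarith
  mem_Stub a' v δ j _ _ y hy hl := by
    change y ∈ stair X w₀ (fun t => Λ.ρ a' (C.lev δ v t)) (C.Hfull v δ) at hy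
    change y ∈ stair X w₀ (fun t => Λ.ρ a' (C.lev δ v t)) (C.Stub v δ j)
    rw [mem_stair] at hy ⊢
    exact ⟨C.mem_Stub_of_mem_Hfull hy.1 hl, hy.2⟩
  mem_Face a' v δ j _ _ y hy hl := by
    change y ∈ stair X w₀ (fun t => Λ.ρ a' (C.lev δ v t)) (C.Hfull v δ) at hy
    change y ∈ stair X w₀ (fun t => Λ.ρ a' (C.lev δ v t)) (C.Face v δ j)
    rw [mem_stair] at hy ⊢
    exact ⟨C.mem_Face_of_mem_Hfull hy.1 hl, hy.2⟩
  Face_far a' v δ j hjK t ht := by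
    change t ∈ stair X w₀ (fun t => Λ.ρ a' (C.lev δ v t)) (C.Face v δ (j + 1)) at ht
    rw [mem_stair] at ht
    obtain ⟨hE, hl⟩ := Face_far' C (by change j + 1 ≤ C.K at hjK; exact hjK) ht.1
    refine ⟨?_, hl⟩
    change t ∈ ballFin X w₀ (Λ.F a') ×ˢ C.Efar v δ
    exact Finset.mem_product.2 ⟨ballFin_mono X w₀ (hΛ.ρ_le_F a' _) ht.2, hE⟩
  M_far a' v δ t ht := by
    obtain ⟨h1, h2⟩ := Finset.mem_product.1 ht
    have hl := C.lev_ge_of_mem_M_add (δ := δ) h2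
    have hr : (1 : ℤ) ≤ C.r := by exact_mod_cast C.one_le_r
    have hrK : (C.r : ℤ) = C.K * C.s := by simp [PCells.r]
    refine ⟨Finset.mem_product.2 ⟨ballFin_mono X w₀ (hΛ.rM_le_F a') h1, C.M_add_stepVec_subset_Efar v δ h2⟩, ?_⟩
    change 5 * (C.r : ℤ) + 10 * C.s * (C.K : ℕ) + 1 ≤ C.lev δ v t.2
    nlinarith
  Btw_sep_Efar a a' w δw du hdu := by
    change KNCells.Sep (X □ zdGraph 2) (ballFin X w₀ (Λ.E a) ×ˢ C.Btw w δw) (ballFin X w₀ (Λ.F a') ×ˢ C.Efar (w + stepVec δw) du)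
    rw [← C.Btw_rev' w δw]
    exact sep_prodR X (C.Btw_sep_Efar (w + stepVec δw) (Ne.symm hdu))
  Cell_sep_Efar b a' u v δ huv hux := sep_prodR X (C.Cell_sep_Efar huv hux)
  Zone_sep_Efar b a' u δ' v δ huv hux := sep_prodR X (C.Zone_sep_Efar huv hux δ')

end Geom

end BoxProdZ2

end Transplant

end Summit.CriticalPhenomena.PercolationContinuityZ3.Theorems

end
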